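import Summits.BirchSwinnertonDyer.BirchSwinnertonDyer.Theorems.EisensteinPrimesMazurMCOnCellBKummerCharacterCocycles
import Summits.BirchSwinnertonDyer.BirchSwinnertonDyer.Theorems.EisensteinPrimesMazurMCOnCellBKummerPlaceClasses
import Summits.BirchSwinnertonDyer.BirchSwinnertonDyer.Theorems.EisensteinPrimesX2AlgebraicLambdaGESplitTorsion
import Summits.BirchSwinnertonDyer.Rank1Residual.X10.SelfTwistPartialAgreement
import Summits.BirchSwinnertonDyer.Rank1Residual.X11a.SelmerCompanionBound
import HarnessLib

/-!
# The Kummer-character COUNT: a certified `𝔽_p`-space `V` of characters unramified off the Kummer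
# places and trivial on `Γ_{ℚ_p}` gives `GeneratorCountGE W p b` for `p^{b+2k} ≤ #V`, hence
# `AlgebraicLambdaGE W p (b − m)` at a `μ_an ≤ m` member
# (route `EisensteinPrimes`, crux 3 `MazurMCOnCellB` = stmt-BirchSwinnertonDyer-19033, line `mudescent`,
# stub 4″ `stub_lambdaCountWeak_offLocus`, ALGEBRAIC half; width seat bsd-line-x2-p1-w3, D-0154 row 5)

HONEST FRAMING (cell `bsd-eis`; nothing here proves BSD or a main conjecture; 0 cells move): THEOREMS
ONLY — no definition, no named fact, nothing asserted about any particular curve, closes nothing. FILE 3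
of 3 of the «Kummer-character classes» helper (FILE 1 `…KummerCharacterCocycles`: the cocycles
`σ ↦ χ(σ)·P̃`; FILE 2 `…KummerPlaceClasses`: the Kummer place lemma). The stub stays OPEN class-wide;
what this file adds is a SOCKET in the stub's own currency, parallel to lam-b's
`EisensteinPrimesX2GeneratorCountAtP` (`#T₀ + 1` classes from Tamagawa witnesses + one local kernel
class at `p`): here the classes are GLOBAL — `[σ ↦ χ(σ)·P̃]` for `χ` in a finite group `V` of
continuous characters `Γ_ℚ → ℤ/p` — and the per-pair certificate is `V` itself:

* §1 `generatorCountGE_of_kummerCharacters` — `E = W/ℚ` globally minimal, `p` odd, `E(ℚ_∞)[p^∞]`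
  finite (`hfix`), `#E[p^∞]^{Γ_ℚ} ≤ p^k`, `P̃ ∈ E[p]` non-zero and `Γ_ℚ`-fixed with `E[p]/⟨P̃⟩` free
  of fixed vectors (`hΨ`), `T ⊇` the bad places and the places above `p`; `V` a finite group of
  characters each of which is (i) trivial on `Γ_{ℚ_v}` for `v ∣ p`, and (ii) at every `v ∤ p` EITHER
  unramified OR at a KUMMER place (split multiplicative, `v(j)` not a `p`-th power in the value group).
  Then **`GeneratorCountGE W p b` whenever `p^{b + 2k} ≤ #V`**: the classes `θ(V) ≤ H¹(ℚ, E[p])`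
  (`#θ(V) = #V` by FILE 1's injectivity) are Kummer off `T` (unramified ⊆ Kummer at good places, tree
  `X10.SelfTwist.unramifiedSubgroup_le_kummerLocalConditionAt_of_hasGoodReductionAt`; Kummer places by
  FILE 2), Kummer at `∞` (`p` odd, `X11a.SelmerCompanion.mem_selmerLocalKer_infinitePlace_of_odd`), and
  Selmer over `ℚ_∞` on `T` (`Additive.…_of_mem_unramified_sup_kummer` at `v ∤ p`; at `v ∣ p` the
  localisation VANISHES), so eisenstein-p1's lossy count
  `X1.GeneratorCountTorsion.natCard_le_natCard_quotient_maximalIdeal_mul_sq` applies VERBATIM.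
* §2 `X2.generatorCountGE_of_kummerCharacters_of_dvd_torsionOrder` — at an odd MULTIPLICATIVE `p` with
  `p ∣ #E(ℚ)_tors`: `P̃` from the rational torsion (lam-b's `exists_fixed_geomTorsion_of_dvd_torsionOrder`),
  `hfix` from the twisted Tate uniformisation (tree `_holds`), `k = v_p(#E(ℚ)_tors)`
  (`X1.GeneratorCountTorsion.natCard_fixedPoints_le_pow_factorization_torsionOrder`);
  `X2.algebraicLambdaGE_of_kummerCharacters_of_dvd_torsionOrder` — **`AlgebraicLambdaGE W p (b − m)`**
  at a `μ_an ≤ m` member through `X2.algebraicLambdaGE_of_generatorCountGE_of_analyticMuLE` (p469158;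
  named facts `hWu`, `hpar`, `h415` exactly as there). NO Poitou–Tate input: the classes are explicit.

WHAT THIS DOES NOT DO. It does not STACK with the Tamagawa count `#T₀ + 1` (by Poitou–Tate,
`#Sel_𝓖 = p^{#T₀+1}·#Sel_{𝓖*}` and the strict Kummer-character classes live in `Sel_{𝓖*}` — a
follow-up inside `Additive.finite_and_pow_le_card_selmerGroup_of_kummer_le`); it does not discharge
`hΨ` (for `K = ℚ`, `p` odd this is `μ_p(ℚ) = 1` + the Weil pairing) nor produce `V` (class field
theory: per pair, the degree-`p` subfields of `ℚ(ζ_ℓ)`, `ℓ ≡ 1 (mod p)` a Kummer prime, in which `p`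
splits — a certificate). At a layer `n ≥ 1` the same count holds for characters of `Γ_{ℚ_n}`; their
number is governed by the image of the cyclotomic units modulo the Kummer places (Greenberg–Vatsal
type A: «we can prove very little»), which is why the socket is stated at layer `0`.

References: [GreenbergLNM1716] §5, proof of Prop. 5.10 (the subgroup `A`; held copy chunks
p0147–p0149), §3 pp. 85–93, p. 137; [GreenbergVatsal2000] §2 pp. 14–15, p. 5; [Wuthrich2014] Thm. 16;
[MilneADT2006] I §2, §6; HOME/bsd-eis HANDOFF «bsd-line-x2-p1 (LEAD) FINAL» NEXT (3).
-/

set_option autoImplicit false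
-- `Summit.BirchSwinnertonDyer.BirchSwinnertonDyer.…`: the summit and its single sub-problem share a name (D-0017 layout).
set_option linter.dupNamespace false

noncomputable section

open scoped Classical

open Function Field NumberField IsDedekindDomain WeierstrassCurve
  Literature.NumberTheory.EllipticCurves Literature.NumberTheory.GaloisRepresentations
  Literature.NumberTheory.EllipticCurves.Rank1Residual Literature.NumberTheory.EllipticCurves.ModularForms
  Summit.BirchSwinnertonDyer.Rank1Residual
  Summit.BirchSwinnertonDyer.Rank1Residual.X1.GeneratorCountSqueeze
  Summit.BirchSwinnertonDyer.Rank1Residual.X1.TamagawaSqueeze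
  Summit.BirchSwinnertonDyer.BirchSwinnertonDyer.Theorems.EisensteinPrimesAlgebraicLambdaGEBudget
  Summit.BirchSwinnertonDyer.BirchSwinnertonDyer.Theorems.EisensteinPrimesX2GeneratorCountAtP
  Summit.BirchSwinnertonDyer.BirchSwinnertonDyer.Theorems.EisensteinPrimesX2AlgebraicLambdaGESplitTorsion
  Summit.BirchSwinnertonDyer.BirchSwinnertonDyer.Theorems.EisensteinPrimesMazurMCOnCellBKummerCharacterCocycles
  Summit.BirchSwinnertonDyer.BirchSwinnertonDyer.Theorems.EisensteinPrimesMazurMCOnCellBKummerPlaceClasses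

namespace Summit.BirchSwinnertonDyer.BirchSwinnertonDyer.Theorems.EisensteinPrimesMazurMCOnCellBKummerCharacterCount

variable {W : WeierstrassCurve ℚ} [W.IsElliptic] [W.IsGloballyMinimal] {p : ℕ} [hp : Fact p.Prime]

/-! ## §1. The count: `GeneratorCountGE W p b` for `p^{b + 2k} ≤ #V` -/

/-- **The Kummer-character count.** `E = W/ℚ` globally minimal, `p` odd, `E(ℚ_∞)[p^∞]` finite for the
cyclotomic `κ` (`hfix`), `#E[p^∞]^{Γ_ℚ} ≤ p^k`, `P̃ ∈ E[p]` non-zero and `Γ_ℚ`-fixed such that every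
`Q ∈ E[p]` with `σQ − Q ∈ ℤ·P̃` for all `σ` lies in `ℤ·P̃` (`hΨ`), `T` a finite set of finite places
containing every bad place and every place above `p`, and `V` a finite group of continuous characters
`χ : Γ_ℚ →ₜ* Multiplicative (ZMod p)` such that every `χ ∈ V` is (i) trivial on `Γ_{ℚ_v}` for
`v ∣ p` (`hVp`) and (ii) at every `v ∤ p` unramified (`χ(res τ) = 1` on `absInertia ℚ_v`) OR `v` is a
KUMMER place of `E` (split multiplicative with `v(j(E))` not a `p`-th power in the value group) (`hV`).
Then `GeneratorCountGE W p b` for every `b` with `p^{b + 2k} ≤ #V`: for every cyclotomic torsion dual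
datum `X`, `p^b ≤ #(X/𝔪X)`. The classes are `θ(χ) = [σ ↦ χ(σ)·P̃]` (FILE 1), `#θ(V) = #V`; each is
Kummer off `T` and at `∞`, and Selmer over `ℚ_∞` on `T` (FILE 2 at the Kummer places), so the lossy
count `#S ≤ #(X/𝔪X)·(#E[p^∞]^{Γ_ℚ})²` applies.
[cite: GreenbergLNM1716, §5 proof of Prop. 5.10, §3 pp. 85–93, p. 137] [cite: GreenbergVatsal2000, §2 pp. 14–15] -/
theorem generatorCountGE_of_kummerCharacters (hodd : p ≠ 2)
    (hfix : ∀ κ : ZpExtension ℚ p, κ.IsCyclotomic →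
      Finite (FixedPoints.addSubgroup κ.kerSubgroup (W.geomPrimaryTorsion p)))
    {k : ℕ}
    (hB : Nat.card {a : geomPrimaryTorsion W p // ∀ σ : absoluteGaloisGroup ℚ, σ • a = a} ≤ p ^ k)
    (Pt : geomTorsion W (p : ℤ)) (hPt : ∀ σ : absoluteGaloisGroup ℚ, σ • Pt = Pt) (hPt0 : Pt ≠ 0)
    (hΨ : ∀ Q : geomTorsion W (p : ℤ),
      (∀ σ : absoluteGaloisGroup ℚ, σ • Q - Q ∈ AddSubgroup.zmultiples Pt) →
        Q ∈ AddSubgroup.zmultiples Pt)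
    (T : Finset (HeightOneSpectrum (𝓞 ℚ))) (hTbad : ∀ v, ¬ W.HasGoodReductionAt v → v ∈ T)
    (hTp : ∀ v : HeightOneSpectrum (𝓞 ℚ), ((p : ℕ) : 𝓞 ℚ) ∈ v.asIdeal → v ∈ T)
    (V : Subgroup (absoluteGaloisGroup ℚ →ₜ* Multiplicative (ZMod p))) [Finite V]
    (hVp : ∀ χ ∈ V, ∀ v : HeightOneSpectrum (𝓞 ℚ), ((p : ℕ) : 𝓞 ℚ) ∈ v.asIdeal →
      ∀ σ : absoluteGaloisGroup (v.adicCompletion ℚ), χ (resGal (K := ℚ) (v.adicCompletion ℚ) σ) = 1)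
    (hV : ∀ χ ∈ V, ∀ v : HeightOneSpectrum (𝓞 ℚ), ((p : ℕ) : 𝓞 ℚ) ∉ v.asIdeal →
      (∀ τ ∈ absInertia (v.adicCompletion ℚ), χ (resGal (K := ℚ) (v.adicCompletion ℚ) τ) = 1) ∨
      (W.HasSplitMultiplicativeReductionAt v ∧ ∀ x : v.adicCompletion ℚ,
        Valued.v (algebraMap ℚ (v.adicCompletion ℚ) W.j) ≠ Valued.v x ^ p))
    {b : ℕ} (hb : p ^ (b + 2 * k) ≤ Nat.card V) : GeneratorCountGE W p b := by
  haveI : NeZero p := ⟨hp.out.ne_zero⟩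
  intro κ γ hκ _ _ D _ _
  haveI := hfix κ hκ
  -- the global cocycles and the class map `θ`
  choose φ hφ using fun χ : absoluteGaloisGroup ℚ →ₜ* Multiplicative (ZMod p) ↦
    exists_cocycle_of_character W χ Pt hPt
  have hφ_mul : ∀ χ₁ χ₂ : absoluteGaloisGroup ℚ →ₜ* Multiplicative (ZMod p),
      φ (χ₁ * χ₂) = φ χ₁ + φ χ₂ := fun χ₁ χ₂ ↦ by
    have hpPt : p • Pt = 0 := Subtype.ext (by
      rw [AddSubgroupClass.coe_nsmul, ZeroMemClass.coe_zero]
      exact AddSubgroup.torsionBy.nsmul_iff.mp Pt.2)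
    apply Subtype.ext
    refine ContinuousMap.ext fun σ ↦ ?_
    rw [Submodule.coe_add, ContinuousMap.add_apply, hφ, hφ, hφ, ContinuousMonoidHom.mul_apply, toAdd_mul,
      ZMod.val_add, ← nsmul_eq_mod_nsmul _ hpPt, add_nsmul]
  have hφ_one : φ 1 = 0 := by
    apply Subtype.ext
    refine ContinuousMap.ext fun σ ↦ ?_
    rw [Submodule.coe_zero, ContinuousMap.zero_apply, hφ, ContinuousMonoidHom.coe_one, Pi.one_apply, toAdd_one,
      ZMod.val_zero, zero_smul]
  let θ : (absoluteGaloisGroup ℚ →ₜ* Multiplicative (ZMod p)) →* Multiplicative (galH1Torsion W (p : ℤ)) :=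
    { toFun := fun χ ↦ Multiplicative.ofAdd
        (oneCocycleClass (discreteTopRep (absoluteGaloisGroup ℚ) (geomTorsion W (p : ℤ))) (φ χ))
      map_one' := by rw [hφ_one, oneCocycleClass_zero]; rfl
      map_mul' := fun χ₁ χ₂ ↦ by rw [hφ_mul, oneCocycleClass_add]; rfl }
  have hθ : ∀ χ, Multiplicative.toAdd (θ χ) =
      oneCocycleClass (discreteTopRep (absoluteGaloisGroup ℚ) (geomTorsion W (p : ℤ))) (φ χ) :=
    fun χ ↦ rfl
  have hθinj : Function.Injective θ := by
    rw [← MonoidHom.ker_eq_bot_iff, Subgroup.eq_bot_iff_forall]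
    intro χ hχ
    exact character_eq_one_of_oneCocycleClass_eq_zero W χ Pt hPt hPt0 hΨ (φ χ) (hφ χ)
      (toAdd_eq_zero.mpr ((MonoidHom.mem_ker).mp hχ))
  -- the subgroup `S = θ(V)` of `H¹(ℚ, E[p])`
  let S : AddSubgroup (galH1Torsion W (p : ℤ)) := Subgroup.toAddSubgroup' (V.map θ)
  have hSmem : ∀ y ∈ S, ∃ χ ∈ V,
      oneCocycleClass (discreteTopRep (absoluteGaloisGroup ℚ) (geomTorsion W (p : ℤ))) (φ χ) = y := by
    intro y hy
    obtain ⟨χ, hχV, hχy⟩ := Subgroup.mem_map.mp ((Subgroup.mem_toAddSubgroup' _ _).mp hy)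
    exact ⟨χ, hχV, by rw [← hθ, hχy]; rfl⟩
  haveI hSfin : Finite S := by
    haveI : Finite (V.map θ) := Finite.of_surjective _ (MonoidHom.subgroupMap_surjective θ V)
    exact Finite.of_equiv (V.map θ) (Equiv.refl _)
  have hScard : Nat.card S = Nat.card V := by
    rw [← Subgroup.card_map_of_injective hθinj (K := V)]
    rfl
  -- the local characters and the localisations
  have hφloc : ∀ (χ : absoluteGaloisGroup ℚ →ₜ* Multiplicative (ZMod p)) (v : HeightOneSpectrum (𝓞 ℚ))
      (σ : absoluteGaloisGroup (v.adicCompletion ℚ)),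
      (φ χ).1 (resGal (K := ℚ) (v.adicCompletion ℚ) σ) =
        (Multiplicative.toAdd ((χ.comp (resGal (K := ℚ) (v.adicCompletion ℚ))) σ)).val • Pt :=
    fun χ v σ ↦ hφ χ _
  -- at `v ∤ p`: the localisation is unramified or Kummer
  have hsup : ∀ χ ∈ V, ∀ v : HeightOneSpectrum (𝓞 ℚ), ((p : ℕ) : 𝓞 ℚ) ∉ v.asIdeal →
      galoisCohomology.res (W.torsionGaloisModule (p : ℤ)) (v.adicCompletion ℚ) 1
          (oneCocycleClass (discreteTopRep (absoluteGaloisGroup ℚ) (geomTorsion W (p : ℤ))) (φ χ)) ∈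
        DiscreteGaloisModule.unramifiedSubgroup
            ((W.torsionGaloisModule (p : ℤ)).restrictField (v.adicCompletion ℚ)) 1 ⊔
          W.kummerLocalConditionAt (p : ℤ) (v.adicCompletion ℚ) := by
    intro χ hχ v hpv
    rcases hV χ hχ v hpv with hur | ⟨hsplit, hj⟩
    · exact AddSubgroup.mem_sup_left (res_oneCocycleClass_mem_unramifiedSubgroup_of_inertia W v Pt
        (χ.comp (resGal (K := ℚ) (v.adicCompletion ℚ))) hur (φ χ) (hφloc χ v))
    · exact AddSubgroup.mem_sup_right (res_oneCocycleClass_mem_kummerLocalConditionAt_of_split W v hsplit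
        hj Pt hPt (χ.comp (resGal (K := ℚ) (v.adicCompletion ℚ))) (φ χ) (hφloc χ v))
  -- every class of `S` is admissible: Kummer off `T` and at `∞`, Selmer over `ℚ_∞` on `T`
  have hcount := X1.GeneratorCountTorsion.natCard_le_natCard_quotient_maximalIdeal_mul_sq W κ D S
    (↑T : Set (HeightOneSpectrum (𝓞 ℚ))) (fun y hy v hv ↦ by
      obtain ⟨χ, hχV, rfl⟩ := hSmem y hy
      have hvT : v ∉ T := fun h ↦ hv (Finset.mem_coe.mpr h)
      have hgood : W.HasGoodReductionAt v := by_contra fun h ↦ hvT (hTbad v h)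
      have hpv : ((p : ℕ) : 𝓞 ℚ) ∉ v.asIdeal := fun h ↦ hvT (hTp v h)
      rw [← W.comap_res_kummerLocalConditionAt (p : ℤ) (v.adicCompletion ℚ)]
      refine AddSubgroup.mem_comap.mpr ?_
      rcases hV χ hχV v hpv with hur | ⟨hsplit, hj⟩
      · exact X10.SelfTwist.unramifiedSubgroup_le_kummerLocalConditionAt_of_hasGoodReductionAt W hgood
          (p : ℤ) (res_oneCocycleClass_mem_unramifiedSubgroup_of_inertia W v Pt
            (χ.comp (resGal (K := ℚ) (v.adicCompletion ℚ))) hur (φ χ) (hφloc χ v))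
      · exact res_oneCocycleClass_mem_kummerLocalConditionAt_of_split W v hsplit hj Pt hPt
          (χ.comp (resGal (K := ℚ) (v.adicCompletion ℚ))) (φ χ) (hφloc χ v))
    (fun y _ w ↦ X11a.SelmerCompanion.mem_selmerLocalKer_infinitePlace_of_odd W hodd hp.out w y)
    fun y hy v _ ↦ by
      obtain ⟨χ, hχV, rfl⟩ := hSmem y hy
      by_cases hpv : ((p : ℕ) : 𝓞 ℚ) ∈ v.asIdeal
      · -- `χ` is trivial on `Γ_{ℚ_p}`: the localisation vanishes
        have h0 := res_oneCocycleClass_eq_zero_of_trivial W v Pt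
          (χ.comp (resGal (K := ℚ) (v.adicCompletion ℚ))) (hVp χ hχV v hpv) (φ χ) (hφloc χ v)
        exact layerToInfty_resH1Hom_torsionToPrimaryH1_mem_localKerOver_of_map_res_mem_zmultiples W p
          κ v 0 (map_zero _) _ (by rw [h0, map_zero]; exact zero_mem _)
      · exact Additive.layerToInfty_resH1Hom_torsionToPrimaryH1_mem_localKerOver_of_mem_unramified_sup_kummer
          W p κ v hpv (Additive.exists_apply_resGal_ne_one_of_isCyclotomic κ hκ v hpv) _
          (hsup χ hχV v hpv)
  have h1 : p ^ b * p ^ (2 * k) ≤ Nat.card (D.X ⧸ IsLocalRing.maximalIdeal (IwasawaAlgebra p) •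
      (⊤ : Submodule (IwasawaAlgebra p) D.X)) * p ^ (2 * k) :=
    calc p ^ b * p ^ (2 * k) = p ^ (b + 2 * k) := (pow_add p b (2 * k)).symm
      _ ≤ Nat.card V := hb
      _ = Nat.card S := hScard.symm
      _ ≤ _ := hcount
      _ ≤ Nat.card (D.X ⧸ IsLocalRing.maximalIdeal (IwasawaAlgebra p) •
            (⊤ : Submodule (IwasawaAlgebra p) D.X)) * (p ^ k) ^ 2 :=
          Nat.mul_le_mul_left _ (Nat.pow_le_pow_left hB 2)
      _ = _ := by rw [← pow_mul, mul_comm k 2]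
  exact Nat.le_of_mul_le_mul_right h1 (pow_pos hp.out.pos _)


/-! ## §2. X2: a multiplicative Eisenstein prime with rational `p`-torsion -/

/-- **X2 count from rational `p`-torsion.** `W/ℚ` globally minimal, `p` odd of MULTIPLICATIVE reduction
with `p ∣ #E(ℚ)_tors` (the étale end of a type-A class with `φ = 𝟙`), `hΨ` for every non-zero fixed
`P̃ ∈ E[p]`, `T`, `V` as in §1 with `p^{b + 2·v_p(#E(ℚ)_tors)} ≤ #V`. Then `GeneratorCountGE W p b` —
§1 with `P̃` from the rational torsion (`exists_fixed_geomTorsion_of_dvd_torsionOrder`), `E(ℚ_∞)[p^∞]`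
finite at `p ‖ N` (twisted Tate uniformisation, tree `_holds`) and `#E[p^∞]^{Γ_ℚ} ≤ p^{v_p(#E(ℚ)_tors)}`
(`X1.GeneratorCountTorsion.natCard_fixedPoints_le_pow_factorization_torsionOrder`).
[cite: GreenbergLNM1716, §1 p. 62, §5 pp. 114–118, p. 137] [cite: SilvermanATAEC1994, Thm. V.5.3, Cor. V.5.4] -/
theorem X2.generatorCountGE_of_kummerCharacters_of_dvd_torsionOrder (hodd : p ≠ 2)
    (hmult : W.HasMultiplicativeReductionAtPrime p) (htors : p ∣ W.torsionOrder)
    (hΨ : ∀ Pt : geomTorsion W (p : ℤ), Pt ≠ 0 → (∀ σ : absoluteGaloisGroup ℚ, σ • Pt = Pt) →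
      ∀ Q : geomTorsion W (p : ℤ),
        (∀ σ : absoluteGaloisGroup ℚ, σ • Q - Q ∈ AddSubgroup.zmultiples Pt) →
          Q ∈ AddSubgroup.zmultiples Pt)
    (T : Finset (HeightOneSpectrum (𝓞 ℚ))) (hTbad : ∀ v, ¬ W.HasGoodReductionAt v → v ∈ T)
    (hTp : ∀ v : HeightOneSpectrum (𝓞 ℚ), ((p : ℕ) : 𝓞 ℚ) ∈ v.asIdeal → v ∈ T)
    (V : Subgroup (absoluteGaloisGroup ℚ →ₜ* Multiplicative (ZMod p))) [Finite V]
    (hVp : ∀ χ ∈ V, ∀ v : HeightOneSpectrum (𝓞 ℚ), ((p : ℕ) : 𝓞 ℚ) ∈ v.asIdeal →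
      ∀ σ : absoluteGaloisGroup (v.adicCompletion ℚ), χ (resGal (K := ℚ) (v.adicCompletion ℚ) σ) = 1)
    (hV : ∀ χ ∈ V, ∀ v : HeightOneSpectrum (𝓞 ℚ), ((p : ℕ) : 𝓞 ℚ) ∉ v.asIdeal →
      (∀ τ ∈ absInertia (v.adicCompletion ℚ), χ (resGal (K := ℚ) (v.adicCompletion ℚ) τ) = 1) ∨
      (W.HasSplitMultiplicativeReductionAt v ∧ ∀ x : v.adicCompletion ℚ,
        Valued.v (algebraMap ℚ (v.adicCompletion ℚ) W.j) ≠ Valued.v x ^ p))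
    {b : ℕ} (hb : p ^ (b + 2 * (W.torsionOrder).factorization p) ≤ Nat.card V) :
    GeneratorCountGE W p b := by
  obtain ⟨Pt, hPt0, hPt⟩ := exists_fixed_geomTorsion_of_dvd_torsionOrder W p htors
  exact generatorCountGE_of_kummerCharacters hodd
    (fun κ hκ ↦ X2.GreenbergVatsalTransferMultiplicative.finite_fixedPoints_kerSubgroup_of_hasMultiplicativeReductionAtPrime
      W p TateCurve.Silverman1994_thmV53_corV54_tateUniformisation_holds hodd hmult κ hκ)
    (X1.GeneratorCountTorsion.natCard_fixedPoints_le_pow_factorization_torsionOrder W p) Pt hPt hPt0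
    (hΨ Pt hPt0 hPt) T hTbad hTp V hVp hV hb

/-- **X2, the λ-bound in the stub's currency: `AlgebraicLambdaGE W p (b − m)` for
`p^{b + 2·v_p(#E(ℚ)_tors)} ≤ #V` at a member with `μ_an ≤ m`** (`p ‖ N` odd with `p ∣ #E(ℚ)_tors`, so
`E[p]` is reducible): §2's count through `X2.algebraicLambdaGE_of_generatorCountGE_of_analyticMuLE`
(p469158: Greenberg's `#(X/𝔪X) ≤ p^{λ+μ}`, Prop. 4.15 (ii) at `p ‖ N`, Wuthrich Thm. 16 for
`μ ≤ μ_an ≤ m`). At the étale end (`m = 0`, `v_p(#tors) = 1`) with `#V = p^d`: `λ(X(E/ℚ_∞)) ≥ d − 2`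
from `d` independent Kummer characters — the layer-`0` generator budget at the KUMMER primes, IN THE
KERNEL modulo `h415` / `hWu` / modularity and the certificate `V`.
[cite: GreenbergLNM1716, §5 pp. 114–118, p. 137, Prop. 4.15 (ii)] [cite: Wuthrich2014, Thm. 16 (p. 397)] -/
theorem X2.algebraicLambdaGE_of_kummerCharacters_of_dvd_torsionOrder (hodd : p ≠ 2)
    (h415 : Greenberg1999.prop415ii_noFiniteSubmodule_of_ordinary_or_multiplicative)
    (hWu : Wuthrich2014.thm16_charIdeal_dvd_multiplicative_of_reducible)
    (hpar : nonempty_modularParametrizationData)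
    (hmult : W.HasMultiplicativeReductionAtPrime p) (htors : p ∣ W.torsionOrder)
    (hΨ : ∀ Pt : geomTorsion W (p : ℤ), Pt ≠ 0 → (∀ σ : absoluteGaloisGroup ℚ, σ • Pt = Pt) →
      ∀ Q : geomTorsion W (p : ℤ),
        (∀ σ : absoluteGaloisGroup ℚ, σ • Q - Q ∈ AddSubgroup.zmultiples Pt) →
          Q ∈ AddSubgroup.zmultiples Pt)
    (T : Finset (HeightOneSpectrum (𝓞 ℚ))) (hTbad : ∀ v, ¬ W.HasGoodReductionAt v → v ∈ T)
    (hTp : ∀ v : HeightOneSpectrum (𝓞 ℚ), ((p : ℕ) : 𝓞 ℚ) ∈ v.asIdeal → v ∈ T)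
    (V : Subgroup (absoluteGaloisGroup ℚ →ₜ* Multiplicative (ZMod p))) [Finite V]
    (hVp : ∀ χ ∈ V, ∀ v : HeightOneSpectrum (𝓞 ℚ), ((p : ℕ) : 𝓞 ℚ) ∈ v.asIdeal →
      ∀ σ : absoluteGaloisGroup (v.adicCompletion ℚ), χ (resGal (K := ℚ) (v.adicCompletion ℚ) σ) = 1)
    (hV : ∀ χ ∈ V, ∀ v : HeightOneSpectrum (𝓞 ℚ), ((p : ℕ) : 𝓞 ℚ) ∉ v.asIdeal →
      (∀ τ ∈ absInertia (v.adicCompletion ℚ), χ (resGal (K := ℚ) (v.adicCompletion ℚ) τ) = 1) ∨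
      (W.HasSplitMultiplicativeReductionAt v ∧ ∀ x : v.adicCompletion ℚ,
        Valued.v (algebraMap ℚ (v.adicCompletion ℚ) W.j) ≠ Valued.v x ^ p))
    {m : ℕ} (hμ : X2.AnalyticMuLE W p m)
    {b : ℕ} (hb : p ^ (b + 2 * (W.torsionOrder).factorization p) ≤ Nat.card V) :
    AlgebraicLambdaGE W p (b - m) :=
  X2.algebraicLambdaGE_of_generatorCountGE_of_analyticMuLE hWu hpar h415 hodd hmult
    (not_hasIrreducibleModPGaloisRep_of_dvd_torsionOrder W p htors) hμ
    (X2.generatorCountGE_of_kummerCharacters_of_dvd_torsionOrder hodd hmult htors hΨ T hTbad hTp V hVp hV hb)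

end Summit.BirchSwinnertonDyer.BirchSwinnertonDyer.Theorems.EisensteinPrimesMazurMCOnCellBKummerCharacterCount

end
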